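import Summits.Ventures.PercRepro.C041BlockMapSubdiv

/-!
# ROW C-041 — TRANSPORT OF THE BLOCK MAP: re-indexing the exits and isomorphic hosts (p6, gen 34)

Setting of `C041BlockMapMultilinear` / `C041BlockMapSubdiv`.  Two invariances of `blockMap Z₁ u a₁ w` that let
the surgery theorems of the row be composed across the bookkeeping of index and vertex types: (1) RE-INDEXING THE
EXITS along an equivalence `e : ι' ≃ ι` (`blockMap_reindex`: `blockMap Z₁ (u ∘ e) a₁ (w ∘ e) = blockMap Z₁ u a₁ w`);
(2) ISOMORPHIC HOSTS — a bijection of the vertices `fv : V₁ ≃ V₂` and of the edges `fe : E₁ ≃ E₂` that carries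
`Joins` (`hJ : ∀ e x y, Z₂.Joins (fe e) (fv x) (fv y) ↔ Z₁.Joins e x y`) carries every monochromatic path
(`reflTransGen_iso_iff`), hence every status, hence the block map (`blockMap_iso`: `blockMap Z₂ (fv ∘ u) (fv a₁) w =
blockMap Z₁ u a₁ w`).  Both are theorems about the colouring terms, summed through the obvious equivalences of
colourings.
-/

namespace PercRepro

namespace ZoneZ

namespace MultiExit

open ZoneData Pendant Finset TwoExit TreeClosure

/-! ## Re-indexing the exits -/

section Reindex

variable {ι ι' V₁ E₁ U₁ U₂ : Type} (Z₁ : ZoneData V₁ E₁ U₁ U₂) (u : ι → V₁) (a₁ : V₁) (e : ι' ≃ ι)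
variable [Fintype ι] [Fintype ι'] (ω : E₁ → Bool)

/-- The merged set of the re-indexed exits. -/
theorem merged_reindex : merged Z₁ (u ∘ e) a₁ ω = (merged Z₁ u a₁ ω).map e.symm.toEmbedding := by
  ext k
  rw [Finset.mem_map_equiv, mem_merged, mem_merged, Equiv.symm_symm, Function.comp_apply]

/-- The block of a re-indexed exit. -/
theorem blk_reindex (k : ι') : blk Z₁ (u ∘ e) a₁ ω k = (blk Z₁ u a₁ ω (e k)).map e.symm.toEmbedding := by
  ext l
  rw [Finset.mem_map_equiv, mem_blk, mem_blk, Equiv.symm_symm, Function.comp_apply, Function.comp_apply]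

/-- The blocks of the re-indexed exits. -/
theorem blocks_reindex :
    blocks Z₁ (u ∘ e) a₁ ω = (blocks Z₁ u a₁ ω).map (Finset.mapEmbedding e.symm.toEmbedding).toEmbedding := by
  ext B
  rw [Finset.mem_map, mem_blocks]
  simp only [RelEmbedding.coe_toEmbedding, Finset.mapEmbedding_apply, mem_blocks]
  constructor
  · rintro ⟨k, hk, rfl⟩
    exact ⟨_, ⟨e k, by rwa [Function.comp_apply] at hk, rfl⟩, (blk_reindex Z₁ u a₁ e ω k).symm⟩
  · rintro ⟨B₀, ⟨k, hk, rfl⟩, rfl⟩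
    refine ⟨e.symm k, ?_, ?_⟩
    · rw [Function.comp_apply, Equiv.apply_symm_apply]
      exact hk
    · rw [blk_reindex, Equiv.apply_symm_apply]

/-- The colouring term of the re-indexed exits. -/
theorem colTerm_reindex (w : ι → Vec6) :
    colTerm Z₁ (u ∘ e) a₁ ω (w ∘ e) = colTerm Z₁ u a₁ ω w := by
  unfold colTerm
  rw [merged_reindex, blocks_reindex, Finset.prod_map, Finset.prod_map]
  simp only [Equiv.coe_toEmbedding, RelEmbedding.coe_toEmbedding, Finset.mapEmbedding_apply, Finset.prod_map,
    Function.comp_apply, Equiv.apply_symm_apply]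

variable [Fintype E₁] [DecidableEq E₁]

/-- **The block map is invariant under re-indexing the exits.** -/
theorem blockMap_reindex (w : ι → Vec6) : blockMap Z₁ (u ∘ e) a₁ (w ∘ e) = blockMap Z₁ u a₁ w := by
  rw [blockMap_eq_sum_colTerm, blockMap_eq_sum_colTerm]
  exact Finset.sum_congr rfl fun ω _ => colTerm_reindex Z₁ u a₁ e ω w

end Reindex

/-! ## Isomorphic hosts -/

section Iso

variable {V₁ E₁ U₁ W₁ V₂ E₂ U₂ W₂ : Type} (Z₁ : ZoneData V₁ E₁ U₁ W₁) (Z₂ : ZoneData V₂ E₂ U₂ W₂)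
  (fv : V₁ ≃ V₂) (fe : E₁ ≃ E₂) (hJ : ∀ e x y, Z₂.Joins (fe e) (fv x) (fv y) ↔ Z₁.Joins e x y)
include hJ

/-- An adjacency carried by the isomorphism. -/
theorem cAdj_iso_iff (c : Bool) (ω : E₁ → Bool) (x y : V₁) :
    cAdj Z₂ c (ω ∘ fe.symm) (fv x) (fv y) ↔ cAdj Z₁ c ω x y := by
  constructor
  · rintro ⟨e₂, hj, hc⟩
    refine ⟨fe.symm e₂, ?_, hc⟩
    rw [← hJ, Equiv.apply_symm_apply]
    exact hj
  · rintro ⟨e₁, hj, hc⟩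
    refine ⟨fe e₁, (hJ e₁ x y).2 hj, ?_⟩
    rw [Function.comp_apply, Equiv.symm_apply_apply]
    exact hc

/-- A monochromatic path carried by the isomorphism. -/
theorem reflTransGen_iso_iff (c : Bool) (ω : E₁ → Bool) (x y : V₁) :
    Relation.ReflTransGen (cAdj Z₂ c (ω ∘ fe.symm)) (fv x) (fv y) ↔ Relation.ReflTransGen (cAdj Z₁ c ω) x y := by
  constructor
  · intro h
    have key : ∀ z, Relation.ReflTransGen (cAdj Z₂ c (ω ∘ fe.symm)) (fv x) z →
        Relation.ReflTransGen (cAdj Z₁ c ω) x (fv.symm z) := by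
      intro z hz
      induction hz with
      | refl =>
        rw [Equiv.symm_apply_apply]
      | tail _ hstep ih =>
        refine ih.tail ((cAdj_iso_iff Z₁ Z₂ fv fe hJ c ω _ _).1 ?_)
        rwa [Equiv.apply_symm_apply, Equiv.apply_symm_apply]
    have := key _ h
    rwa [Equiv.symm_apply_apply] at this
  · intro h
    induction h with
    | refl => exact Relation.ReflTransGen.refl
    | tail _ hstep ih => exact ih.tail ((cAdj_iso_iff Z₁ Z₂ fv fe hJ c ω _ _).2 hstep)

/-- Merged status carried by the isomorphism. -/
theorem Mg_iso (ω : E₁ → Bool) (x y : V₁) : Z₂.Mg (fv x) (fv y) (ω ∘ fe.symm) ↔ Z₁.Mg x y ω := by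
  rw [Mg_iff_reflTransGen, Mg_iff_reflTransGen]
  exact reflTransGen_iso_iff Z₁ Z₂ fv fe hJ false ω x y

/-- Reached status carried by the isomorphism. -/
theorem Rd_iso (ω : E₁ → Bool) (x y : V₁) : Z₂.Rd (fv x) (fv y) (ω ∘ fe.symm) ↔ Z₁.Rd x y ω := by
  rw [Rd_iff_reflTransGen, Rd_iff_reflTransGen]
  exact reflTransGen_iso_iff Z₁ Z₂ fv fe hJ true ω x y

variable {ι : Type} (u : ι → V₁) (a₁ : V₁) [Fintype ι] (ω : E₁ → Bool)

/-- The merged set carried by the isomorphism. -/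
theorem merged_iso : merged Z₂ (fv ∘ u) (fv a₁) (ω ∘ fe.symm) = merged Z₁ u a₁ ω := by
  ext k
  rw [mem_merged, mem_merged, Function.comp_apply, Mg_iso Z₁ Z₂ fv fe hJ]

/-- The blocks carried by the isomorphism. -/
theorem blk_iso : blk Z₂ (fv ∘ u) (fv a₁) (ω ∘ fe.symm) = blk Z₁ u a₁ ω := by
  funext k
  ext l
  rw [mem_blk, mem_blk, Function.comp_apply, Function.comp_apply, Mg_iso Z₁ Z₂ fv fe hJ, Mg_iso Z₁ Z₂ fv fe hJ]

/-- The blocks carried by the isomorphism. -/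
theorem blocks_iso : blocks Z₂ (fv ∘ u) (fv a₁) (ω ∘ fe.symm) = blocks Z₁ u a₁ ω := by
  ext B
  rw [mem_blocks, mem_blocks]
  simp only [Function.comp_apply, Mg_iso Z₁ Z₂ fv fe hJ, blk_iso Z₁ Z₂ fv fe hJ]

/-- The colouring term carried by the isomorphism. -/
theorem colTerm_iso (w : ι → Vec6) :
    colTerm Z₂ (fv ∘ u) (fv a₁) (ω ∘ fe.symm) w = colTerm Z₁ u a₁ ω w := by
  unfold colTerm
  rw [merged_iso Z₁ Z₂ fv fe hJ, blocks_iso Z₁ Z₂ fv fe hJ]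
  simp only [Function.comp_apply, Rd_iso Z₁ Z₂ fv fe hJ]

variable [Fintype E₁] [DecidableEq E₁] [Fintype E₂] [DecidableEq E₂]

/-- **The block map is invariant under isomorphisms of hosts.** -/
theorem blockMap_iso (w : ι → Vec6) : blockMap Z₂ (fv ∘ u) (fv a₁) w = blockMap Z₁ u a₁ w := by
  rw [blockMap_eq_sum_colTerm, blockMap_eq_sum_colTerm,
    ← Fintype.sum_equiv (Equiv.arrowCongr fe (Equiv.refl Bool))
      (fun ω₁ => colTerm Z₂ (fv ∘ u) (fv a₁) ((Equiv.arrowCongr fe (Equiv.refl Bool)) ω₁) w) _ (fun _ => rfl)]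
  refine Finset.sum_congr rfl fun ω _ => ?_
  have h : (Equiv.arrowCongr fe (Equiv.refl Bool)) ω = ω ∘ fe.symm := by
    funext e
    rw [Equiv.arrowCongr_apply, Function.comp_apply, Function.comp_apply, Equiv.refl_apply]
  rw [h]
  exact colTerm_iso Z₁ Z₂ fv fe hJ u a₁ ω w

end Iso

end MultiExit

end ZoneZ

end PercRepro
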